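import Summits.QuantumFields.BalabanUV.Beta.GAN24.WilsonSectorRate
import Summits.QuantumFields.BalabanUV.Beta.GAN24.CombWilsonSectorRow

/-!
# hSdev for the (III′) cubic-Wilson lineage `combWilsonAt` FROM hS0 and a (III′) contact-term RATE END with the CONJUGATED dressed leg chains

NOT IN PRINT — OUR BOOKKEEPING (road-P2 = `b2b-balaban-gan24-p2` gen 56, 2026-08-25; row G-an2-4 ∕ (CONV-C), the (α-0) chain at row D1's literal
OF RECORD (III′) `JsB12CombShSym`; [folklore] composition BY NAME; 0 `def`, 0 cite, 0 `def … : Prop`, 0 `sorry`).  Weight 0.  NEVER «G-an2-4 closed» as (CONV-C);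
NOT D1, NOT BetaPertH, NOT continuum, NOT Clay; NO campaign opened (an2 W-4).

This is the (III′) twin of the OWNER gan24-p1 g22's (E) `GAN24/WilsonSectorRate` §2 for M.50's lineage `CombWilsonSector.combWilsonAt Lc cE` (`d = 3`, `2 ≤ Lc`, the literal's
pin `cE = Lc^4`).  Notation as in M.52 `CombWilsonSectorRow`: `T′_k = legChain (fun j ↦ legComp ψ♭ R_j) 0 k` (conjugated dressed chain at the centred root), `B_k = respStep 1 (Lc^(k+1))`.
At (E) hS0 was UNCONDITIONAL inside (`WilsonSectorRowHolds`); at (III′) it is the HYPOTHESIS `hS0` (supplied by M.52 `exists_hS0_combWilson_of_contact` from the (III′) contact END),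
and the contact-term RATE END `hCTd′` is the (E) part 2 END's shape VERBATIM (`ContactCauchyAssembly.exists_contact_supRate_of_atoms`) with `T′` for `T` and no root quantifier.
* **`supRate_unitS_combWilsonAt_of_contactRate`** — the ONE-STEP SUP-NORM RATE of the unit tables `U n = unitS_n (combWilsonAt Lc cE n)`: `∃ c ρ, 0 ≤ c ∧ 1∕2 ≤ ρ < 1 ∧
  ∀ n κ u, SupBound (U (n+1) κ u − U n κ u) (c·ρ^n)`; steps `n ≥ 2` = road S3's undressed difference row `TaylorRowDWThree.rowDW_three` (UNCHANGED at (III′)) in `push₃` currency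
  (`e3OfS_smul_eq_push₃`) + `hCTd′` (`Lc^4 ×` table currency, `weight_succ_eq ∕ weight_eq_pow` BY NAME); steps `n = 0, 1` by `hS0`; M.50 `unitS_combWilsonAt_succ_eq_push₃`.
* **`exists_hSdev_combWilson_of_contactRate`** — hSdev: `∃ cS θS δS, 0 ≤ cS ∧ 0 ≤ θS ∧ θS < 1 ∧ 0 < δS ∧ ∀ k j, LocStencil (U (k+j) − U k) (cS·θS^k) δS` (road S3's interpolation
  `StencilSlotSupRate.locStencilCauchy_of_uniform_supRate`, `θS = √ρ`, `δS ↦ δS∕2`).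
* **`exists_hS0_hSdev_combWilson_of_contact_ENDs`** — both Wilson letters of M.53 `CombSRowsOfSectors` from the TWO (III′) contact ENDs (`hCT′` row shape, `hCTd′` rate shape):
  THE (III′) WILSON HALF OF THE S-SLOT IS REDUCED TO EXACTLY THESE TWO ENDS (memo `gen55/S-CAMPAIGN-SIZING-g55.v0_3.md` §3(a): the composite-leg cells; «engine first»; nobody).
Discharges NOTHING by itself; 0 wall binders.
-/

noncomputable section

open Finset
open scoped BigOperators
open Literature.MathematicalPhysics.QuantumFieldTheory
open Literature.MathematicalPhysics.QuantumFieldTheory.Balaban1983to89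
open Literature.MathematicalPhysics.QuantumFieldTheory.Balaban1983to89.Beta
open B4ContourShift (supNorm)
open ExpKernelCalculus (MKer)
open OneStepResolventKernel (Fib LocStencil)
open StepJetData (wilsonA)
open AffineAveraging (Site box toSite)
open AveragingContoursRooted (ctr ctrOff)
open BalabanCompositeJets (respStep)
open Summit.QuantumFields.BalabanUV.Beta.HessKerDressedUnits (unitS)
open Summit.QuantumFields.BalabanUV.Beta.GAN24.CombesThomas (sfStep smStep SupBound)
open Summit.QuantumFields.BalabanUV.Beta.GAN24.Push4 (IsFF legComp)
open Summit.QuantumFields.BalabanUV.Beta.GAN24.Push4Iter (legChain)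
open Summit.QuantumFields.BalabanUV.Beta.GAN24.RespStepBmDecompExact (respStepBmSeq)
open Summit.QuantumFields.BalabanUV.Beta.GAN24.Push3 (push₃ isFF_push₃)
open Summit.QuantumFields.BalabanUV.Beta.GAN24.E3UnitSplit (e3OfS)
open Summit.QuantumFields.BalabanUV.Beta.GAN24.SrecWilsonSector (isFF_wilsonA)
open Summit.QuantumFields.BalabanUV.Beta.GAN24.StencilSlotOfShapes (locStencil_mono')
open Summit.QuantumFields.BalabanUV.Beta.GAN24.WilsonSectorUndressedRow (e3OfS_smul_eq_push₃)
open Summit.QuantumFields.BalabanUV.Beta.GAN24.WilsonSectorRate (supBound_sub_of_locStencil weight_succ_eq weight_eq_pow)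
open Summit.QuantumFields.BalabanUV.Beta.GAN24.TaylorRowDWThree (rowDW_three)
open Summit.QuantumFields.BalabanUV.Beta.GAN24.StencilSlotSupRate (locStencilCauchy_of_uniform_supRate)
open Summit.QuantumFields.BalabanUV.Beta.SymCorrectorKernel (psiKS)
open Summit.QuantumFields.BalabanUV.Beta.GAN24.CombWilsonSector (combWilsonAt unitS_combWilsonAt_succ_eq_push₃)
open Summit.QuantumFields.BalabanUV.Beta.GAN24.CombWilsonSectorRow (exists_hS0_combWilson_of_contact)

namespace Summit.QuantumFields.BalabanUV.Beta.GAN24.CombWilsonSectorRate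

variable {Lc : ℕ} [NeZero Lc]

/-- NOT IN PRINT; OUR BOOKKEEPING ([folklore]; the (III′) twin of the OWNER's (E) `WilsonSectorRate.supRate_unitS_wilsonSecAt_of_contactRate`).  **THE ONE-STEP SUP-NORM RATE OF THE
UNIT (III′) WILSON TABLES** (`d = 3`, `2 ≤ Lc`, pin `cE = Lc^4`), CONDITIONAL on hS0 (`hS0`, M.52's conclusion shape) and on the (III′) contact-term rate `hCTd′` (the (E) part 2 END's
shape with the conjugated chains `T′`): there are `c ≥ 0` and `ρ ∈ [1∕2, 1)` with, for every `n` and every coarse bond `(κ, u)`, `SupBound (U (n+1) κ u − U n κ u) (c·ρ^n)`,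
`U n = unitS (sfStep Lc n) (smStep 3 Lc n) (combWilsonAt Lc cE n)`.  Steps `n ≥ 2`: road S3's `rowDW_three` (undressed legs — unchanged at (III′) —, `push₃` currency by
`e3OfS_smul_eq_push₃`, weight `Lc^4 ×` the row-W weight) + `hCTd′` (`Lc^4 ×` table currency); steps `n = 0, 1`: the uniform letter `hS0` (`2·Cs ≤ (2Cs∕ρ²)·ρ^n`). -/
theorem supRate_unitS_combWilsonAt_of_contactRate (hLc : 2 ≤ Lc) {cE : ℝ} (hcE : cE = (Lc : ℝ) ^ (3 + 1))
    (hS0 : ∃ Cs δS : ℝ, 0 < δS ∧ ∀ j : ℕ, LocStencil (unitS (sfStep Lc j) (smStep 3 Lc j) (combWilsonAt (d := 3) Lc cE j)) Cs δS)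
    (hCTd : ∃ K ϑ : ℝ, 0 ≤ K ∧ 0 ≤ ϑ ∧ ϑ < 1 ∧
      ∀ (k : ℕ) (κ₁ : Fin (3 + 1)) (u' x' z' : Site (3 + 1)) (α β : Fin (3 + 1)),
        |(Lc : ℝ) ^ (12 * (k + 2)) *
            (push₃
            (legChain (fun j => legComp (fun α x κ u => psiKS (ctrOff (3 + 1) Lc) Lc u x (Sum.inl κ) (Sum.inl α)) (respStepBmSeq (d := 3) (ctr (3 + 1) Lc) Lc j)) 0 (k + 1))
            (legChain (fun j => legComp (fun α x κ u => psiKS (ctrOff (3 + 1) Lc) Lc u x (Sum.inl κ) (Sum.inl α)) (respStepBmSeq (d := 3) (ctr (3 + 1) Lc) Lc j)) 0 (k + 1))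
            (legChain (fun j => legComp (fun α x κ u => psiKS (ctrOff (3 + 1) Lc) Lc u x (Sum.inl κ) (Sum.inl α)) (respStepBmSeq (d := 3) (ctr (3 + 1) Lc) Lc j)) 0 (k + 1))
            (wilsonA 3) κ₁ u' x' z' (Sum.inl α) (Sum.inl β)
              - push₃ (respStep (d := 3) 1 (Lc ^ (k + 2))) (respStep (d := 3) 1 (Lc ^ (k + 2))) (respStep (d := 3) 1 (Lc ^ (k + 2)))
                (wilsonA 3) κ₁ u' x' z' (Sum.inl α) (Sum.inl β))
          - (Lc : ℝ) ^ (12 * (k + 1)) *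
            (push₃
            (legChain (fun j => legComp (fun α x κ u => psiKS (ctrOff (3 + 1) Lc) Lc u x (Sum.inl κ) (Sum.inl α)) (respStepBmSeq (d := 3) (ctr (3 + 1) Lc) Lc j)) 0 k)
            (legChain (fun j => legComp (fun α x κ u => psiKS (ctrOff (3 + 1) Lc) Lc u x (Sum.inl κ) (Sum.inl α)) (respStepBmSeq (d := 3) (ctr (3 + 1) Lc) Lc j)) 0 k)
            (legChain (fun j => legComp (fun α x κ u => psiKS (ctrOff (3 + 1) Lc) Lc u x (Sum.inl κ) (Sum.inl α)) (respStepBmSeq (d := 3) (ctr (3 + 1) Lc) Lc j)) 0 k)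
            (wilsonA 3) κ₁ u' x' z' (Sum.inl α) (Sum.inl β)
              - push₃ (respStep (d := 3) 1 (Lc ^ (k + 1))) (respStep (d := 3) 1 (Lc ^ (k + 1))) (respStep (d := 3) 1 (Lc ^ (k + 1)))
                (wilsonA 3) κ₁ u' x' z' (Sum.inl α) (Sum.inl β))|
          ≤ K * ϑ ^ k) :
    ∃ c ρ : ℝ, 0 ≤ c ∧ (1 / 2 : ℝ) ≤ ρ ∧ ρ < 1 ∧
      ∀ (n : ℕ) (κ : Fin (3 + 1)) (u : Site (3 + 1)),
        SupBound (unitS (sfStep Lc (n + 1)) (smStep 3 Lc (n + 1)) (combWilsonAt (d := 3) Lc cE (n + 1)) κ u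
          - unitS (sfStep Lc n) (smStep 3 Lc n) (combWilsonAt (d := 3) Lc cE n) κ u) (c * ρ ^ n) := by
  have hL : (0 : ℝ) < (Lc : ℝ) := by exact_mod_cast Nat.pos_of_ne_zero (NeZero.ne Lc)
  obtain ⟨Cs, δS, hδS, hS0⟩ := hS0
  obtain ⟨eW, θ, hθ0, hθ1, hDW⟩ := rowDW_three (Lc := Lc) hLc cE
  obtain ⟨K, ϑ, hK, hϑ0, hϑ1, hC⟩ := hCTd
  -- one rate, bounded away from zero
  set ρ : ℝ := max (max θ ϑ) (1 / 2 : ℝ) with hρ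
  have hθρ : θ ≤ ρ := (le_max_left _ _).trans (le_max_left _ _)
  have hϑρ : ϑ ≤ ρ := (le_max_right _ _).trans (le_max_left _ _)
  have hρh : (1 / 2 : ℝ) ≤ ρ := le_max_right _ _
  have hρ0 : 0 < ρ := lt_of_lt_of_le (by norm_num) hρh
  have hρ1 : ρ < 1 := max_lt (max_lt hθ1 hϑ1) (by norm_num)
  have hρle1 : ρ ≤ 1 := hρ1.le
  set Cs' : ℝ := max Cs 0 with hCs'
  have hCs'0 : 0 ≤ Cs' := le_max_right _ _
  set c : ℝ := 2 * Cs' / ρ ^ 2 + (Lc : ℝ) ^ (3 + 1) * (|eW| + K) / ρ with hc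
  have hc0 : 0 ≤ c := by positivity
  refine ⟨c, ρ, hc0, hρh, hρ1, fun n κ u => ?_⟩
  have hS0' : ∀ j : ℕ, LocStencil (unitS (sfStep Lc j) (smStep 3 Lc j) (combWilsonAt (d := 3) Lc cE j)) Cs' δS :=
    fun j => locStencil_mono' (hS0 j) (le_max_left _ _) le_rfl
  rcases Nat.lt_or_ge n 2 with hn | hn
  · -- the steps `(1,0)` and `(2,1)`: the uniform letter
    have hsup := supBound_sub_of_locStencil (hS0' (n + 1)) (hS0' n) hδS.le hδS.le hCs'0 hCs'0 κ u
    intro x y a b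
    refine (hsup x y a b).trans ?_
    have hρn : ρ ^ 2 ≤ ρ ^ n := pow_le_pow_of_le_one hρ0.le hρle1 (by omega)
    have hρ20 : 0 < ρ ^ 2 := pow_pos hρ0 2
    calc Cs' + Cs' = (2 * Cs' / ρ ^ 2) * ρ ^ 2 := by field_simp; ring
      _ ≤ (2 * Cs' / ρ ^ 2) * ρ ^ n := mul_le_mul_of_nonneg_left hρn (by positivity)
      _ ≤ c * ρ ^ n := mul_le_mul_of_nonneg_right (by rw [hc]; exact le_add_of_nonneg_right (by positivity)) (pow_nonneg hρ0.le n)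
  · -- the steps `n = m + 2 ≥ 2`: road S3's undressed difference row + the (III′) contact-term rate
    obtain ⟨m, rfl⟩ : ∃ m, n = m + 2 := ⟨n - 2, by omega⟩
    have h3 := unitS_combWilsonAt_succ_eq_push₃ (d := 3) Lc cE (m + 2)
    have h2 := unitS_combWilsonAt_succ_eq_push₃ (d := 3) Lc cE (m + 1)
    rw [show m + 2 + 1 = m + 3 from rfl] at h3 ⊢
    rw [show m + 1 + 1 = m + 2 from rfl] at h2
    rw [h3, h2]
    intro x z a b
    simp only [Pi.sub_apply, Pi.smul_apply, smul_eq_mul]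
    -- the weights at the pin
    have hw3 := weight_succ_eq (Lc := Lc) hcE (m + 2)
    have hw2 := weight_succ_eq (Lc := Lc) hcE (m + 1)
    have hw3' := weight_eq_pow (Lc := Lc) hcE (m + 2)
    have hw2' := weight_eq_pow (Lc := Lc) hcE (m + 1)
    rw [show m + 2 + 1 = m + 3 from rfl] at hw3 hw3'
    rw [show m + 1 + 1 = m + 2 from rfl] at hw2 hw2'
    -- the target constant
    have hρm0 : 0 ≤ ρ ^ (m + 1) := pow_nonneg hρ0.le _
    have hgoal : (Lc : ℝ) ^ (3 + 1) * (|eW| * θ ^ (m + 1) + K * ϑ ^ (m + 1)) ≤ c * ρ ^ (m + 2) := by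
      have e1 : θ ^ (m + 1) ≤ ρ ^ (m + 1) := pow_le_pow_left₀ hθ0 hθρ _
      have e2 : ϑ ^ (m + 1) ≤ ρ ^ (m + 1) := pow_le_pow_left₀ hϑ0 hϑρ _
      calc (Lc : ℝ) ^ (3 + 1) * (|eW| * θ ^ (m + 1) + K * ϑ ^ (m + 1)) ≤ (Lc : ℝ) ^ (3 + 1) * ((|eW| + K) * ρ ^ (m + 1)) := by
            refine mul_le_mul_of_nonneg_left ?_ (by positivity)
            nlinarith [abs_nonneg eW, hK]
        _ = ((Lc : ℝ) ^ (3 + 1) * (|eW| + K) / ρ) * ρ ^ (m + 2) := by field_simp; ring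
        _ ≤ c * ρ ^ (m + 2) :=
            mul_le_mul_of_nonneg_right (by rw [hc]; exact le_add_of_nonneg_left (by positivity)) (pow_nonneg hρ0.le _)
    rcases b with β | ν
    · rcases a with α | μ
      · -- ff entry: undressed difference + contact difference
        set PT3 := push₃ (legChain (fun j => legComp (fun α x κ u => psiKS (ctrOff (3 + 1) Lc) Lc u x (Sum.inl κ) (Sum.inl α)) (respStepBmSeq (d := 3) (ctr (3 + 1) Lc) Lc j)) 0 (m + 2)) (legChain (fun j => legComp (fun α x κ u => psiKS (ctrOff (3 + 1) Lc) Lc u x (Sum.inl κ) (Sum.inl α)) (respStepBmSeq (d := 3) (ctr (3 + 1) Lc) Lc j)) 0 (m + 2))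
          (legChain (fun j => legComp (fun α x κ u => psiKS (ctrOff (3 + 1) Lc) Lc u x (Sum.inl κ) (Sum.inl α)) (respStepBmSeq (d := 3) (ctr (3 + 1) Lc) Lc j)) 0 (m + 2)) (wilsonA 3) κ u x z (Sum.inl α) (Sum.inl β) with hPT3
        set PT2 := push₃ (legChain (fun j => legComp (fun α x κ u => psiKS (ctrOff (3 + 1) Lc) Lc u x (Sum.inl κ) (Sum.inl α)) (respStepBmSeq (d := 3) (ctr (3 + 1) Lc) Lc j)) 0 (m + 1)) (legChain (fun j => legComp (fun α x κ u => psiKS (ctrOff (3 + 1) Lc) Lc u x (Sum.inl κ) (Sum.inl α)) (respStepBmSeq (d := 3) (ctr (3 + 1) Lc) Lc j)) 0 (m + 1))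
          (legChain (fun j => legComp (fun α x κ u => psiKS (ctrOff (3 + 1) Lc) Lc u x (Sum.inl κ) (Sum.inl α)) (respStepBmSeq (d := 3) (ctr (3 + 1) Lc) Lc j)) 0 (m + 1)) (wilsonA 3) κ u x z (Sum.inl α) (Sum.inl β) with hPT2
        set PB3 := push₃ (respStep (d := 3) 1 (Lc ^ (m + 3))) (respStep (d := 3) 1 (Lc ^ (m + 3))) (respStep (d := 3) 1 (Lc ^ (m + 3)))
          (wilsonA 3) κ u x z (Sum.inl α) (Sum.inl β) with hPB3
        set PB2 := push₃ (respStep (d := 3) 1 (Lc ^ (m + 2))) (respStep (d := 3) 1 (Lc ^ (m + 2))) (respStep (d := 3) 1 (Lc ^ (m + 2)))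
          (wilsonA 3) κ u x z (Sum.inl α) (Sum.inl β) with hPB2
        -- the undressed pair: road S3's difference row, read in push currency
        have hX := hDW m κ u x z (Sum.inl α) (Sum.inl β)
        rw [show m + 1 + 1 + 1 = m + 3 from rfl, show m + 1 + 1 = m + 2 from rfl] at hX
        rw [e3OfS_smul_eq_push₃ (N := Lc ^ (m + 3)) (isFF_wilsonA (d := 3)), e3OfS_smul_eq_push₃ (N := Lc ^ (m + 2)) (isFF_wilsonA (d := 3))] at hX
        simp only [Pi.smul_apply, smul_eq_mul] at hX
        have hU : |cE * (cE * (Lc : ℝ) ^ (2 * (3 + 1))) ^ (m + 3) * PB3 - cE * (cE * (Lc : ℝ) ^ (2 * (3 + 1))) ^ (m + 2) * PB2|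
            ≤ (Lc : ℝ) ^ (3 + 1) * (|eW| * θ ^ (m + 1)) := by
          have e : cE * (cE * (Lc : ℝ) ^ (2 * (3 + 1))) ^ (m + 3) * PB3 - cE * (cE * (Lc : ℝ) ^ (2 * (3 + 1))) ^ (m + 2) * PB2
              = (Lc : ℝ) ^ (3 + 1) * ((((Lc : ℝ) ^ (m + 3)) ^ (2 * (3 + 1)) * ((cE * ((Lc : ℝ) ^ (3 + 1)) ^ (m + 2)) * PB3))
                - (((Lc : ℝ) ^ (m + 2)) ^ (2 * (3 + 1)) * ((cE * ((Lc : ℝ) ^ (3 + 1)) ^ (m + 1)) * PB2))) := by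
            rw [hw3, hw2]; ring
          rw [e, abs_mul, abs_of_nonneg (by positivity : (0 : ℝ) ≤ (Lc : ℝ) ^ (3 + 1))]
          refine mul_le_mul_of_nonneg_left (hX.trans ?_) (by positivity)
          exact mul_le_mul_of_nonneg_right (le_abs_self eW) (pow_nonneg hθ0 _)
        -- the contact pair: the (III′) rate END in table currency
        have hY := hC (m + 1) κ u x z α β
        rw [show m + 1 + 2 = m + 3 from rfl, show m + 1 + 1 = m + 2 from rfl] at hY
        have hV : |cE * (cE * (Lc : ℝ) ^ (2 * (3 + 1))) ^ (m + 3) * (PT3 - PB3) - cE * (cE * (Lc : ℝ) ^ (2 * (3 + 1))) ^ (m + 2) * (PT2 - PB2)|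
            ≤ (Lc : ℝ) ^ (3 + 1) * (K * ϑ ^ (m + 1)) := by
          have e : cE * (cE * (Lc : ℝ) ^ (2 * (3 + 1))) ^ (m + 3) * (PT3 - PB3) - cE * (cE * (Lc : ℝ) ^ (2 * (3 + 1))) ^ (m + 2) * (PT2 - PB2)
              = (Lc : ℝ) ^ (3 + 1) * ((Lc : ℝ) ^ (12 * (m + 3)) * (PT3 - PB3) - (Lc : ℝ) ^ (12 * (m + 2)) * (PT2 - PB2)) := by
            rw [hw3', hw2']; ring
          rw [e, abs_mul, abs_of_nonneg (by positivity : (0 : ℝ) ≤ (Lc : ℝ) ^ (3 + 1))]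
          exact mul_le_mul_of_nonneg_left hY (by positivity)
        have esplit : cE * (cE * (Lc : ℝ) ^ (2 * (3 + 1))) ^ (m + 3) * PT3 - cE * (cE * (Lc : ℝ) ^ (2 * (3 + 1))) ^ (m + 2) * PT2
            = (cE * (cE * (Lc : ℝ) ^ (2 * (3 + 1))) ^ (m + 3) * PB3 - cE * (cE * (Lc : ℝ) ^ (2 * (3 + 1))) ^ (m + 2) * PB2)
              + (cE * (cE * (Lc : ℝ) ^ (2 * (3 + 1))) ^ (m + 3) * (PT3 - PB3) - cE * (cE * (Lc : ℝ) ^ (2 * (3 + 1))) ^ (m + 2) * (PT2 - PB2)) := by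
          ring
        rw [esplit]
        refine (abs_add_le _ _).trans ((add_le_add hU hV).trans ?_)
        rw [← mul_add]
        exact hgoal
      · -- a multiplier row index: the pushes vanish
        simp only [Push3.push₃_inr_left, mul_zero, sub_zero, abs_zero]
        positivity
    · simp only [Push3.push₃_inr_right, mul_zero, sub_zero, abs_zero]
      positivity

/-- NOT IN PRINT; OUR BOOKKEEPING ([folklore]; the (III′) twin of the OWNER's (E) `WilsonSectorRate.exists_hSdev_wilsonSec_of_contactRate`).  **hSdev FOR THE (III′) CUBIC-WILSON
LINEAGE** (`d = 3`, `2 ≤ Lc`, pin `cE = Lc^4`), CONDITIONAL on hS0 (`hS0`) and the (III′) contact-term rate (`hCTd′`):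
`∃ cS θS δS, 0 ≤ cS ∧ 0 ≤ θS ∧ θS < 1 ∧ 0 < δS ∧ ∀ k j, LocStencil (unitS_{k+j} (combWilsonAt Lc cE (k+j)) − unitS_k (combWilsonAt Lc cE k)) (cS·θS^k) δS` — hS0 interpolated
against the one-step sup rate by road S3's `locStencilCauchy_of_uniform_supRate` (`θS = √ρ`, `δS ↦ δS∕2`). -/
theorem exists_hSdev_combWilson_of_contactRate (hLc : 2 ≤ Lc) {cE : ℝ} (hcE : cE = (Lc : ℝ) ^ (3 + 1))
    (hS0 : ∃ Cs δS : ℝ, 0 < δS ∧ ∀ j : ℕ, LocStencil (unitS (sfStep Lc j) (smStep 3 Lc j) (combWilsonAt (d := 3) Lc cE j)) Cs δS)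
    (hCTd : ∃ K ϑ : ℝ, 0 ≤ K ∧ 0 ≤ ϑ ∧ ϑ < 1 ∧
      ∀ (k : ℕ) (κ₁ : Fin (3 + 1)) (u' x' z' : Site (3 + 1)) (α β : Fin (3 + 1)),
        |(Lc : ℝ) ^ (12 * (k + 2)) *
            (push₃
            (legChain (fun j => legComp (fun α x κ u => psiKS (ctrOff (3 + 1) Lc) Lc u x (Sum.inl κ) (Sum.inl α)) (respStepBmSeq (d := 3) (ctr (3 + 1) Lc) Lc j)) 0 (k + 1))
            (legChain (fun j => legComp (fun α x κ u => psiKS (ctrOff (3 + 1) Lc) Lc u x (Sum.inl κ) (Sum.inl α)) (respStepBmSeq (d := 3) (ctr (3 + 1) Lc) Lc j)) 0 (k + 1))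
            (legChain (fun j => legComp (fun α x κ u => psiKS (ctrOff (3 + 1) Lc) Lc u x (Sum.inl κ) (Sum.inl α)) (respStepBmSeq (d := 3) (ctr (3 + 1) Lc) Lc j)) 0 (k + 1))
            (wilsonA 3) κ₁ u' x' z' (Sum.inl α) (Sum.inl β)
              - push₃ (respStep (d := 3) 1 (Lc ^ (k + 2))) (respStep (d := 3) 1 (Lc ^ (k + 2))) (respStep (d := 3) 1 (Lc ^ (k + 2)))
                (wilsonA 3) κ₁ u' x' z' (Sum.inl α) (Sum.inl β))
          - (Lc : ℝ) ^ (12 * (k + 1)) *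
            (push₃
            (legChain (fun j => legComp (fun α x κ u => psiKS (ctrOff (3 + 1) Lc) Lc u x (Sum.inl κ) (Sum.inl α)) (respStepBmSeq (d := 3) (ctr (3 + 1) Lc) Lc j)) 0 k)
            (legChain (fun j => legComp (fun α x κ u => psiKS (ctrOff (3 + 1) Lc) Lc u x (Sum.inl κ) (Sum.inl α)) (respStepBmSeq (d := 3) (ctr (3 + 1) Lc) Lc j)) 0 k)
            (legChain (fun j => legComp (fun α x κ u => psiKS (ctrOff (3 + 1) Lc) Lc u x (Sum.inl κ) (Sum.inl α)) (respStepBmSeq (d := 3) (ctr (3 + 1) Lc) Lc j)) 0 k)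
            (wilsonA 3) κ₁ u' x' z' (Sum.inl α) (Sum.inl β)
              - push₃ (respStep (d := 3) 1 (Lc ^ (k + 1))) (respStep (d := 3) 1 (Lc ^ (k + 1))) (respStep (d := 3) 1 (Lc ^ (k + 1)))
                (wilsonA 3) κ₁ u' x' z' (Sum.inl α) (Sum.inl β))|
          ≤ K * ϑ ^ k) :
    ∃ cS θS δS : ℝ, 0 ≤ cS ∧ 0 ≤ θS ∧ θS < 1 ∧ 0 < δS ∧
      ∀ k j : ℕ, LocStencil (unitS (sfStep Lc (k + j)) (smStep 3 Lc (k + j)) (combWilsonAt (d := 3) Lc cE (k + j))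
        - unitS (sfStep Lc k) (smStep 3 Lc k) (combWilsonAt (d := 3) Lc cE k)) (cS * θS ^ k) δS := by
  obtain ⟨c, ρ, hc, hρh, hρ1, hR⟩ := supRate_unitS_combWilsonAt_of_contactRate (Lc := Lc) hLc hcE hS0 hCTd
  obtain ⟨Cs, δS, hδS, hS0⟩ := hS0
  have hρ0 : 0 ≤ ρ := le_trans (by norm_num) hρh
  set Cs' : ℝ := max Cs 0 with hCs'
  refine ⟨Real.sqrt (2 * (c / (1 - ρ)) * Cs'), Real.sqrt ρ, δS / 2, Real.sqrt_nonneg _, Real.sqrt_nonneg _,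
    (Real.sqrt_lt' one_pos).2 (by rwa [one_pow]), by positivity, fun k j => ?_⟩
  have hS0' : ∀ n : ℕ, LocStencil (unitS (sfStep Lc n) (smStep 3 Lc n) (combWilsonAt (d := 3) Lc cE n)) Cs' δS :=
    fun n => locStencil_mono' (hS0 n) (le_max_left _ _) le_rfl
  exact locStencilCauchy_of_uniform_supRate (F := fun n => unitS (sfStep Lc n) (smStep 3 Lc n) (combWilsonAt (d := 3) Lc cE n))
    hS0' hR hc hρ0 hρ1 k j

/-- NOT IN PRINT; OUR BOOKKEEPING ([folklore]).  **BOTH WILSON LETTERS OF THE (III′) S-SLOT FROM THE TWO (III′) CONTACT ENDs** (`d = 3`, `2 ≤ Lc`, pin `cE = Lc^4`): the row END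
`hCT′` (M.52's hypothesis shape) gives hS0 (M.52 `exists_hS0_combWilson_of_contact`), then with the rate END `hCTd′` hSdev (above) — the pair consumed by M.53
`CombSRowsOfSectors.exists_hS_hSall_ScombOf_of_sectors` as `hW ∕ hWd`.  So the (III′) Wilson half of the S-slot is EXACTLY these two ENDs (the composite-leg cells). -/
theorem exists_hS0_hSdev_combWilson_of_contact_ENDs (hLc : 2 ≤ Lc) {cE : ℝ} (hcE : cE = (Lc : ℝ) ^ (3 + 1))
    (hCT : ∃ κ' K : ℝ, 0 < κ' ∧ 0 ≤ K ∧
      ∀ (k : ℕ) (κ₁ : Fin (3 + 1)) (u' x' z' : Site (3 + 1)) (α β : Fin (3 + 1)),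
        |push₃
            (legChain (fun j => legComp (fun α x κ u => psiKS (ctrOff (3 + 1) Lc) Lc u x (Sum.inl κ) (Sum.inl α)) (respStepBmSeq (d := 3) (ctr (3 + 1) Lc) Lc j)) 0 k)
            (legChain (fun j => legComp (fun α x κ u => psiKS (ctrOff (3 + 1) Lc) Lc u x (Sum.inl κ) (Sum.inl α)) (respStepBmSeq (d := 3) (ctr (3 + 1) Lc) Lc j)) 0 k)
            (legChain (fun j => legComp (fun α x κ u => psiKS (ctrOff (3 + 1) Lc) Lc u x (Sum.inl κ) (Sum.inl α)) (respStepBmSeq (d := 3) (ctr (3 + 1) Lc) Lc j)) 0 k)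
            (wilsonA 3) κ₁ u' x' z' (Sum.inl α) (Sum.inl β)
          - push₃ (respStep (d := 3) 1 (Lc ^ (k + 1))) (respStep (d := 3) 1 (Lc ^ (k + 1))) (respStep (d := 3) 1 (Lc ^ (k + 1)))
            (wilsonA 3) κ₁ u' x' z' (Sum.inl α) (Sum.inl β)|
          ≤ K * ((Lc : ℝ) ^ (12 * (k + 1)))⁻¹ * Real.exp (-(κ' * (supNorm (x' - u') + supNorm (z' - u')))))
    (hCTd : ∃ K ϑ : ℝ, 0 ≤ K ∧ 0 ≤ ϑ ∧ ϑ < 1 ∧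
      ∀ (k : ℕ) (κ₁ : Fin (3 + 1)) (u' x' z' : Site (3 + 1)) (α β : Fin (3 + 1)),
        |(Lc : ℝ) ^ (12 * (k + 2)) *
            (push₃
            (legChain (fun j => legComp (fun α x κ u => psiKS (ctrOff (3 + 1) Lc) Lc u x (Sum.inl κ) (Sum.inl α)) (respStepBmSeq (d := 3) (ctr (3 + 1) Lc) Lc j)) 0 (k + 1))
            (legChain (fun j => legComp (fun α x κ u => psiKS (ctrOff (3 + 1) Lc) Lc u x (Sum.inl κ) (Sum.inl α)) (respStepBmSeq (d := 3) (ctr (3 + 1) Lc) Lc j)) 0 (k + 1))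
            (legChain (fun j => legComp (fun α x κ u => psiKS (ctrOff (3 + 1) Lc) Lc u x (Sum.inl κ) (Sum.inl α)) (respStepBmSeq (d := 3) (ctr (3 + 1) Lc) Lc j)) 0 (k + 1))
            (wilsonA 3) κ₁ u' x' z' (Sum.inl α) (Sum.inl β)
              - push₃ (respStep (d := 3) 1 (Lc ^ (k + 2))) (respStep (d := 3) 1 (Lc ^ (k + 2))) (respStep (d := 3) 1 (Lc ^ (k + 2)))
                (wilsonA 3) κ₁ u' x' z' (Sum.inl α) (Sum.inl β))
          - (Lc : ℝ) ^ (12 * (k + 1)) *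
            (push₃
            (legChain (fun j => legComp (fun α x κ u => psiKS (ctrOff (3 + 1) Lc) Lc u x (Sum.inl κ) (Sum.inl α)) (respStepBmSeq (d := 3) (ctr (3 + 1) Lc) Lc j)) 0 k)
            (legChain (fun j => legComp (fun α x κ u => psiKS (ctrOff (3 + 1) Lc) Lc u x (Sum.inl κ) (Sum.inl α)) (respStepBmSeq (d := 3) (ctr (3 + 1) Lc) Lc j)) 0 k)
            (legChain (fun j => legComp (fun α x κ u => psiKS (ctrOff (3 + 1) Lc) Lc u x (Sum.inl κ) (Sum.inl α)) (respStepBmSeq (d := 3) (ctr (3 + 1) Lc) Lc j)) 0 k)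
            (wilsonA 3) κ₁ u' x' z' (Sum.inl α) (Sum.inl β)
              - push₃ (respStep (d := 3) 1 (Lc ^ (k + 1))) (respStep (d := 3) 1 (Lc ^ (k + 1))) (respStep (d := 3) 1 (Lc ^ (k + 1)))
                (wilsonA 3) κ₁ u' x' z' (Sum.inl α) (Sum.inl β))|
          ≤ K * ϑ ^ k) :
    (∃ Cs δS : ℝ, 0 < δS ∧ ∀ j : ℕ, LocStencil (unitS (sfStep Lc j) (smStep 3 Lc j) (combWilsonAt (d := 3) Lc cE j)) Cs δS) ∧
    (∃ cS θS δS : ℝ, 0 ≤ cS ∧ 0 ≤ θS ∧ θS < 1 ∧ 0 < δS ∧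
      ∀ k j : ℕ, LocStencil (unitS (sfStep Lc (k + j)) (smStep 3 Lc (k + j)) (combWilsonAt (d := 3) Lc cE (k + j))
        - unitS (sfStep Lc k) (smStep 3 Lc k) (combWilsonAt (d := 3) Lc cE k)) (cS * θS ^ k) δS) :=
  have hS0 := exists_hS0_combWilson_of_contact (Lc := Lc) hcE hCT
  ⟨hS0, exists_hSdev_combWilson_of_contactRate hLc hcE hS0 hCTd⟩

end Summit.QuantumFields.BalabanUV.Beta.GAN24.CombWilsonSectorRate

end
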